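import Summits.HubbardSuperconductivity.HubbardSuperconductivity.Theorems.NodalWardXYVisonPairCostDefs

/-!
# The Matsubara log-determinant formula (stub `LogDetFormula` of the line `Sketch`,
# crux `NodalWardXY.VisonPairCost`, stmt-HubbardSuperconductivity-1266)

For Hermitian matrices `A`, `B` of the same size with eigenvalues `λ_i(A)`, `λ_i(B)`,

  `Σ_i |λ_i(A)| − Σ_i |λ_i(B)| = (2/π) ∫₀^∞ D_t dt`,
  `D_t = log ‖det(A + it·1)‖ − log ‖det(B + it·1)‖ = logDetKernel A B t`,

with `D_t` integrable on `(0, ∞)` — the registered stub `stub_logDetFormula : LogDetFormula` of the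
vocabulary file `Theorems/NodalWardXYVisonPairCostDefs.lean`.  Pure Mathlib:

* `det_add_smul_one_eq_prod_eigenvalues` — `det(A + c·1) = Π_i (λ_i + c)` (characteristic polynomial
  `Π_i (X − λ_i)` of a Hermitian matrix, `Matrix.IsHermitian.charpoly_eq`, evaluated at `−c`);
* `norm_det_add_I_smul`, `det_add_I_smul_ne_zero`, and the PUBLIC eigenvalue form
  `log_norm_det_add_I_smul` — `log ‖det(A + it·1)‖ = ½ Σ_i log(λ_i² + t²)` for real `t ≠ 0`;
* `integral_log_sq_add_sq_sub_log_sq(_abs)` — the one-mode integral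
  `∫₀^∞ (log(a² + t²) − log t²) dt = π|a|` with integrability, from the antiderivative
  `t log(a² + t²) − 2t log t + 2|a| arctan(t/|a|)` (`hasDerivAt_modeAntideriv`) via
  `MeasureTheory.integral_Ioi_of_hasDerivAt_of_nonneg` / `integrableOn_Ioi_deriv_of_nonneg`;
* `logDetKernel_eq_sum` — on `t > 0`,
  `D_t = ½ Σ_i [(log(λ_i(A)² + t²) − log t²) − (log(λ_i(B)² + t²) − log t²)]`,
  and the stub by `integral_finsetSum` / `integral_sub`.
-/

noncomputable section

-- tree namespace Summit.HubbardSuperconductivity.HubbardSuperconductivity (D-0017)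
set_option linter.dupNamespace false

namespace Summit.HubbardSuperconductivity.HubbardSuperconductivity.Theorems.VisonPairCost

open MeasureTheory Filter Topology
open scoped Matrix

variable {n : Type*} [Fintype n] [DecidableEq n]

/-- For a Hermitian matrix `A` with eigenvalues `λ_i` and any scalar `c`, `det(A + c·1) = Π_i (λ_i + c)`
(evaluate the characteristic polynomial `Π_i (X − λ_i)` at `−c`). -/
theorem det_add_smul_one_eq_prod_eigenvalues {A : Matrix n n ℂ} (hA : A.IsHermitian) (c : ℂ) :
    (A + c • (1 : Matrix n n ℂ)).det = ∏ i, ((hA.eigenvalues i : ℂ) + c) := by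
  have h1 : A + c • (1 : Matrix n n ℂ) = -(Matrix.scalar n (-c) - A) := by
    rw [neg_sub, Matrix.scalar_apply, ← Matrix.diagonal_neg, sub_neg_eq_add, Matrix.smul_one_eq_diagonal]
  rw [h1, Matrix.det_neg, ← Matrix.eval_charpoly, hA.charpoly_eq, Polynomial.eval_prod]
  simp only [Polynomial.eval_sub, Polynomial.eval_X, Polynomial.eval_C, RCLike.ofReal_eq_complex_ofReal]
  have h2 : ∀ x : ℂ, -c - x = -(x + c) := fun x => by ring
  simp_rw [h2, Finset.prod_neg, Finset.card_univ, ← mul_assoc, ← mul_pow]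
  norm_num

/-- `‖det(A + it·1)‖ = Π_i √(λ_i² + t²)` for Hermitian `A` and real `t`. -/
theorem norm_det_add_I_smul {A : Matrix n n ℂ} (hA : A.IsHermitian) (t : ℝ) :
    ‖(A + ((t : ℂ) * Complex.I) • (1 : Matrix n n ℂ)).det‖ =
      ∏ i, Real.sqrt (hA.eigenvalues i ^ 2 + t ^ 2) := by
  rw [det_add_smul_one_eq_prod_eigenvalues hA, norm_prod]
  exact Finset.prod_congr rfl fun i _ => Complex.norm_add_mul_I _ _

/-- **Eigenvalue form of the Matsubara log-determinant**: for Hermitian `A` and real `t ≠ 0`,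
`log ‖det(A + it·1)‖ = ½ Σ_i log(λ_i² + t²)`. -/
theorem log_norm_det_add_I_smul {A : Matrix n n ℂ} (hA : A.IsHermitian) {t : ℝ} (ht : t ≠ 0) :
    Real.log ‖(A + ((t : ℂ) * Complex.I) • (1 : Matrix n n ℂ)).det‖ =
      (1 / 2) * ∑ i, Real.log (hA.eigenvalues i ^ 2 + t ^ 2) := by
  have hpos : ∀ i, 0 < hA.eigenvalues i ^ 2 + t ^ 2 := fun i => by positivity
  rw [norm_det_add_I_smul hA, Real.log_prod fun i _ => (Real.sqrt_pos.mpr (hpos i)).ne', Finset.mul_sum]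
  exact Finset.sum_congr rfl fun i _ => by rw [Real.log_sqrt (hpos i).le]; ring

/-- `det(A + it·1) ≠ 0` for Hermitian `A` and real `t ≠ 0` (so the Matsubara resolvent `(A + it)⁻¹`
exists). -/
theorem det_add_I_smul_ne_zero {A : Matrix n n ℂ} (hA : A.IsHermitian) {t : ℝ} (ht : t ≠ 0) :
    (A + ((t : ℂ) * Complex.I) • (1 : Matrix n n ℂ)).det ≠ 0 := by
  rw [← norm_pos_iff, norm_det_add_I_smul hA]
  exact Finset.prod_pos fun i _ => Real.sqrt_pos.mpr (by positivity)

/-! ## The one-mode Matsubara integral `∫₀^∞ (log(b² + t²) − log t²) dt = π b` -/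

/-- The one-mode integrand `log(b² + t²) − log t²` is nonnegative on `(0, ∞)`. -/
private theorem modeIntegrand_nonneg (b : ℝ) {t : ℝ} (ht : 0 < t) :
    0 ≤ Real.log (b ^ 2 + t ^ 2) - Real.log (t ^ 2) :=
  sub_nonneg.mpr (Real.log_le_log (by positivity) (by nlinarith [sq_nonneg b]))

/-- For `b, t > 0`: `0 ≤ t log(b² + t²) − 2 t log t ≤ b²/t` (from `log x ≤ x − 1`). -/
private theorem mul_modeIntegrand_mem_Icc {b t : ℝ} (hb : 0 < b) (ht : 0 < t) :
    t * Real.log (b ^ 2 + t ^ 2) - 2 * (t * Real.log t) ∈ Set.Icc 0 (b ^ 2 * t⁻¹) := by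
  have h0 := modeIntegrand_nonneg b ht
  rw [Real.log_pow, Nat.cast_ofNat] at h0
  have hbt : 0 < b ^ 2 + t ^ 2 := by positivity
  have hq : 0 < (b ^ 2 + t ^ 2) / t ^ 2 := by positivity
  have hlog : Real.log (b ^ 2 + t ^ 2) - 2 * Real.log t ≤ (b ^ 2 + t ^ 2) / t ^ 2 - 1 := by
    have := Real.log_le_sub_one_of_pos hq
    rwa [Real.log_div hbt.ne' (by positivity), Real.log_pow, Nat.cast_ofNat] at this
  have ht2 : (b ^ 2 + t ^ 2) / t ^ 2 - 1 = b ^ 2 * t⁻¹ * t⁻¹ := by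
    field_simp
    ring
  constructor
  · calc (0 : ℝ) ≤ t * (Real.log (b ^ 2 + t ^ 2) - 2 * Real.log t) := mul_nonneg ht.le h0
      _ = t * Real.log (b ^ 2 + t ^ 2) - 2 * (t * Real.log t) := by ring
  · calc t * Real.log (b ^ 2 + t ^ 2) - 2 * (t * Real.log t)
        = t * (Real.log (b ^ 2 + t ^ 2) - 2 * Real.log t) := by ring
      _ ≤ t * (b ^ 2 * t⁻¹ * t⁻¹) := by rw [← ht2]; exact mul_le_mul_of_nonneg_left hlog ht.le
      _ = b ^ 2 * t⁻¹ := by field_simp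

/-- For `b, t > 0` the antiderivative `g_b(x) = x log(b² + x²) − 2 x log x + 2b arctan(x/b)` has derivative
`log(b² + t²) − log t²` at `t`. -/
private theorem hasDerivAt_modeAntideriv {b : ℝ} (hb : 0 < b) {t : ℝ} (ht : 0 < t) :
    HasDerivAt (fun x : ℝ => x * Real.log (b ^ 2 + x ^ 2) - 2 * (x * Real.log x) + 2 * b * Real.arctan (x / b))
      (Real.log (b ^ 2 + t ^ 2) - Real.log (t ^ 2)) t := by
  have hbt : 0 < b ^ 2 + t ^ 2 := by positivity
  have h1 : HasDerivAt (fun x : ℝ => b ^ 2 + x ^ 2) (2 * t) t := by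
    simpa using ((hasDerivAt_pow 2 t).const_add (b ^ 2))
  have h2 : HasDerivAt (fun x : ℝ => x * Real.log (b ^ 2 + x ^ 2))
      (1 * Real.log (b ^ 2 + t ^ 2) + t * (2 * t / (b ^ 2 + t ^ 2))) t :=
    (hasDerivAt_id t).mul (h1.log hbt.ne')
  have h3 : HasDerivAt (fun x : ℝ => 2 * (x * Real.log x)) (2 * (Real.log t + 1)) t :=
    (Real.hasDerivAt_mul_log ht.ne').const_mul 2
  have h4 : HasDerivAt (fun x : ℝ => 2 * b * Real.arctan (x / b))
      (2 * b * (1 / (1 + (t / b) ^ 2) * (1 / b))) t :=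
    (((hasDerivAt_id t).div_const b).arctan).const_mul (2 * b)
  have h := (h2.sub h3).add h4
  refine h.congr_deriv ?_
  rw [Real.log_pow]
  field_simp
  ring

/-- **One-mode Matsubara integral**: for `b > 0`, `t ↦ log(b² + t²) − log t²` is integrable on `(0, ∞)`
with integral `π b` — via the antiderivative `g_b(t) = t log(b² + t²) − 2 t log t + 2b arctan(t/b)`, which is
continuous on `ℝ` with `g_b(0) = 0` (Lean's `0 · log 0 = 0`) and tends to `π b` at `+∞`. -/
theorem integral_log_sq_add_sq_sub_log_sq {b : ℝ} (hb : 0 < b) :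
    IntegrableOn (fun t : ℝ => Real.log (b ^ 2 + t ^ 2) - Real.log (t ^ 2)) (Set.Ioi 0) ∧
      ∫ t in Set.Ioi (0 : ℝ), (Real.log (b ^ 2 + t ^ 2) - Real.log (t ^ 2)) = Real.pi * b := by
  set g : ℝ → ℝ := fun x =>
    x * Real.log (b ^ 2 + x ^ 2) - 2 * (x * Real.log x) + 2 * b * Real.arctan (x / b) with hg
  have hcont : Continuous g := by
    have h1 : Continuous fun t : ℝ => Real.log (b ^ 2 + t ^ 2) :=
      Continuous.log (by fun_prop) fun t => by positivity
    exact ((continuous_id.mul h1).sub (continuous_const.mul Real.continuous_mul_log)).add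
      (continuous_const.mul (Real.continuous_arctan.comp (continuous_id.div_const b)))
  have hderiv : ∀ t ∈ Set.Ioi (0 : ℝ), HasDerivAt g (Real.log (b ^ 2 + t ^ 2) - Real.log (t ^ 2)) t :=
    fun t ht => hasDerivAt_modeAntideriv hb ht
  have hpos : ∀ t ∈ Set.Ioi (0 : ℝ), 0 ≤ Real.log (b ^ 2 + t ^ 2) - Real.log (t ^ 2) :=
    fun t ht => modeIntegrand_nonneg b ht
  -- `g(t) → π b`: `t (log(b²+t²) − log t²) → 0` by `0 ≤ · ≤ b²/t`, and `2b arctan(t/b) → 2b · π/2`.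
  have hlim : Tendsto g atTop (𝓝 (Real.pi * b)) := by
    have hA : Tendsto (fun t : ℝ => t * Real.log (b ^ 2 + t ^ 2) - 2 * (t * Real.log t)) atTop (𝓝 0) := by
      have hup : Tendsto (fun t : ℝ => b ^ 2 * t⁻¹) atTop (𝓝 0) := by
        simpa using tendsto_inv_atTop_zero.const_mul (b ^ 2)
      refine tendsto_of_tendsto_of_tendsto_of_le_of_le' tendsto_const_nhds hup ?_ ?_
      · filter_upwards [eventually_gt_atTop 0] with t ht using (mul_modeIntegrand_mem_Icc hb ht).1
      · filter_upwards [eventually_gt_atTop 0] with t ht using (mul_modeIntegrand_mem_Icc hb ht).2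
    have hB : Tendsto (fun t : ℝ => 2 * b * Real.arctan (t / b)) atTop (𝓝 (2 * b * (Real.pi / 2))) := by
      have h1 : Tendsto (fun t : ℝ => t / b) atTop atTop := Filter.Tendsto.atTop_div_const hb tendsto_id
      exact ((Real.tendsto_arctan_atTop.mono_right nhdsWithin_le_nhds).comp h1).const_mul (2 * b)
    have := hA.add hB
    rwa [zero_add, show 2 * b * (Real.pi / 2) = Real.pi * b by ring] at this
  have hg0 : g 0 = 0 := by simp [hg]
  refine ⟨integrableOn_Ioi_deriv_of_nonneg hcont.continuousWithinAt hderiv hpos hlim, ?_⟩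
  rw [integral_Ioi_of_hasDerivAt_of_nonneg hcont.continuousWithinAt hderiv hpos hlim, hg0, sub_zero]

/-- The one-mode integral for an arbitrary real level `a`: `∫₀^∞ (log(a² + t²) − log t²) dt = π |a|`,
with integrability (the case `a = 0` is the zero function). -/
theorem integral_log_sq_add_sq_sub_log_sq_abs (a : ℝ) :
    IntegrableOn (fun t : ℝ => Real.log (a ^ 2 + t ^ 2) - Real.log (t ^ 2)) (Set.Ioi 0) ∧
      ∫ t in Set.Ioi (0 : ℝ), (Real.log (a ^ 2 + t ^ 2) - Real.log (t ^ 2)) = Real.pi * |a| := by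
  rcases eq_or_ne a 0 with rfl | ha
  · simp
  · have h := integral_log_sq_add_sq_sub_log_sq (abs_pos.mpr ha)
    rwa [sq_abs] at h

/-! ## The log-determinant formula -/

/-- On `t > 0` the Matsubara kernel is the finite sum of one-mode integrands:
`D_t = ½ Σ_i [(log(λ_i(A)² + t²) − log t²) − (log(λ_i(B)² + t²) − log t²)]`. -/
theorem logDetKernel_eq_sum {A B : Matrix n n ℂ} (hA : A.IsHermitian) (hB : B.IsHermitian) {t : ℝ}
    (ht : t ≠ 0) :
    logDetKernel A B t =
      (1 / 2) * ∑ i, ((Real.log (hA.eigenvalues i ^ 2 + t ^ 2) - Real.log (t ^ 2)) -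
        (Real.log (hB.eigenvalues i ^ 2 + t ^ 2) - Real.log (t ^ 2))) := by
  rw [logDetKernel, log_norm_det_add_I_smul hA ht, log_norm_det_add_I_smul hB ht, ← mul_sub,
    ← Finset.sum_sub_distrib]
  congr 1
  exact Finset.sum_congr rfl fun i _ => by ring

/-- **Stub `LogDetFormula`** of the line `Sketch`: for Hermitian `A`, `B` of the same size,
`Σ_i |λ_i(A)| − Σ_i |λ_i(B)| = (2/π) ∫₀^∞ (log ‖det(A + it)‖ − log ‖det(B + it)‖) dt`, the integrand
being integrable on `(0, ∞)`. -/
theorem stub_logDetFormula : LogDetFormula := by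
  intro n _ _ A B hA hB
  set K : ℝ → ℝ := fun t => (1 / 2) * ∑ i,
    ((Real.log (hA.eigenvalues i ^ 2 + t ^ 2) - Real.log (t ^ 2)) -
      (Real.log (hB.eigenvalues i ^ 2 + t ^ 2) - Real.log (t ^ 2))) with hK
  have hEq : Set.EqOn (logDetKernel A B) K (Set.Ioi 0) := fun t ht =>
    logDetKernel_eq_sum hA hB (ne_of_gt ht)
  have hI : ∀ a : ℝ, Integrable (fun t : ℝ => Real.log (a ^ 2 + t ^ 2) - Real.log (t ^ 2))
      (volume.restrict (Set.Ioi 0)) := fun a => (integral_log_sq_add_sq_sub_log_sq_abs a).1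
  have hIsub : ∀ i ∈ Finset.univ, Integrable (fun t : ℝ =>
      (Real.log (hA.eigenvalues i ^ 2 + t ^ 2) - Real.log (t ^ 2)) -
        (Real.log (hB.eigenvalues i ^ 2 + t ^ 2) - Real.log (t ^ 2))) (volume.restrict (Set.Ioi 0)) :=
    fun i _ => (hI (hA.eigenvalues i)).sub (hI (hB.eigenvalues i))
  have hKi : IntegrableOn K (Set.Ioi 0) := (integrable_finsetSum _ hIsub).const_mul (1 / 2)
  have hKint : ∫ t in Set.Ioi (0 : ℝ), K t =
      (1 / 2) * ∑ i, (Real.pi * |hA.eigenvalues i| - Real.pi * |hB.eigenvalues i|) := by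
    rw [hK, integral_const_mul, integral_finsetSum _ hIsub]
    congr 1
    refine Finset.sum_congr rfl fun i _ => ?_
    rw [integral_sub (hI (hA.eigenvalues i)) (hI (hB.eigenvalues i)),
      (integral_log_sq_add_sq_sub_log_sq_abs (hA.eigenvalues i)).2,
      (integral_log_sq_add_sq_sub_log_sq_abs (hB.eigenvalues i)).2]
  refine ⟨hKi.congr_fun hEq.symm measurableSet_Ioi, ?_⟩
  rw [setIntegral_congr_fun measurableSet_Ioi hEq, hKint, Finset.sum_sub_distrib, ← Finset.mul_sum,
    ← Finset.mul_sum]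
  field_simp

end Summit.HubbardSuperconductivity.HubbardSuperconductivity.Theorems.VisonPairCost

end
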